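import Mathlib
import HarnessLib
import Literature.Analysis.FluidPDE.CurlIsometryCovariance
import Summits.NavierStokesRegularity.NavierStokesRegularity.Theses.AxisTwistDoor
import Summits.NavierStokesRegularity.NavierStokesRegularity.Theorems.PoloidalWindowDoorPoloidalWindowRigidityRotate
import Summits.NavierStokesRegularity.NavierStokesRegularity.Theorems.HalfSpaceWindowDoorCirculationCarryingRigidityRotate
import Summits.NavierStokesRegularity.NavierStokesRegularity.Theorems.RellichScarSimilarityCovariance

/-!
# Route `AxisTwistDoor`, support item `RotationToAxis` (stmt-NavierStokesRegularity-26890) — rotation covariance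
# of the route's energy-class profile hypotheses: WLOG the sign direction is `e₃`

`RotationToAxis` says: if NO profile of the route's class (Type-I time rate, continuity on the open lower slab,
unit-viscosity Oseen–Duhamel identity, divergence-free slices, suitable weak on the backward slab with a weak spatial
gradient and Albritton–Barker quantity `𝐈 < ∞`) with `⟪curl v, e₃⟫ ≥ 0` everywhere and linear `e₃`-ball growth of the
signed vorticity mass is backward singular at `(0,0)`, then the same holds with `e₃` replaced by any `e ≠ 0`.

Proof (plumbing, no new mathematics): pick a linear isometry `L` of `ℝ³` with `L⁻¹e₃ = e/‖e‖` and `det L = 1`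
(`…HalfSpaceWindowDoorCirculationCarryingRigidityRotate.exists_linearIsometryEquiv_det_one_symm_single_two`) and
conjugate: `v'(t,x) = L v(t, L⁻¹x)`, `π'(t,x) = π(t, L⁻¹x)`, `H'(t,x) = L ∘ H(t, L⁻¹x) ∘ L⁻¹`. The mild class is
transported by `…PoloidalWindowDoorPoloidalWindowRigidityRotate.class_conj_linearIsometryEquiv`, suitability / the
weak gradient / `𝐈` / the backward singularity of the origin by the `RellichScarSimilarityCovariance` covariance lemmas
(`isSuitableWeakSolutionOn_conj`, `hasWeakSpatialGradientOn_conj`, `LIE.typeIBound_lowerHalf_conj`,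
`LIE.isBackwardSingularPoint_zero_conj`), the sign by the pseudovector law of the curl with `det L = 1`
(`inner_curl_conj_linearIsometryEquiv`: `⟪curl v'(s)(y), e₃⟫ = ‖e‖⁻¹ ⟪curl v(s)(L⁻¹y), e⟫`), and the ball growth by
the change of variables `y = L z` on balls (`K ↦ K/‖e‖`). The `e₃`-hypothesis then says `v'` is not backward singular
at the origin, contradicting the transported singularity.

Seat ns-atd-p1 (LEAD of route AxisTwistDoor, KEY-NS #104). WHAT THIS IS NOT: not a statement about Navier–Stokes
regularity — plumbing for a STAGED door route on the leaf `HalfSpaceWindowDoor.Target` (rung N0-LocalTubeDoorHalfSpace);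
the leaf, the route's cruxes `TiltDomination` / `AveragedConeLiouville` and NS regularity remain OPEN.
-/

noncomputable section

-- the summit and its single sub-problem share the name (CONVENTIONS §1), as in every Theorems file
set_option linter.dupNamespace false

namespace Summit.NavierStokesRegularity.NavierStokesRegularity.Theorems.AxisTwistDoorRotationToAxis

open MeasureTheory Set Function Metric
open scoped ENNReal RealInnerProductSpace InnerProductSpace
open Literature.Analysis Literature.Analysis.FluidPDE
open Summit.NavierStokesRegularity.NavierStokesRegularity.Theorems.PoloidalWindowDoorPoloidalWindowRigidityRotate
  (class_conj_linearIsometryEquiv)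
open Summit.NavierStokesRegularity.NavierStokesRegularity.Theorems.HalfSpaceWindowDoorCirculationCarryingRigidityRotate
  (exists_linearIsometryEquiv_det_one_symm_single_two)
open Summit.NavierStokesRegularity.NavierStokesRegularity.Theorems.RellichScarSimilarityCovariance
  (isSuitableWeakSolutionOn_conj hasWeakSpatialGradientOn_conj LIE.typeIBound_lowerHalf_conj
    LIE.isBackwardSingularPoint_zero_conj)

/-- Change of variables on balls under a linear isometry `L` of `ℝ³`:
`∫⁻_{B(x,R)} F(L⁻¹ y) dy = ∫⁻_{B(L⁻¹x, R)} F(z) dz`. -/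
theorem setLIntegral_ball_comp_symm (L : EuclideanSpace ℝ (Fin 3) ≃ₗᵢ[ℝ] EuclideanSpace ℝ (Fin 3)) (R : ℝ)
    (x : EuclideanSpace ℝ (Fin 3)) (F : EuclideanSpace ℝ (Fin 3) → ℝ≥0∞) :
    ∫⁻ y in ball x R, F (L.symm y) = ∫⁻ z in ball (L.symm x) R, F z := by
  have h1 : L.symm ⁻¹' ball (L.symm x) R = ball x R := by
    rw [LinearIsometryEquiv.preimage_ball, LinearIsometryEquiv.symm_symm,
      LinearIsometryEquiv.apply_symm_apply]
  rw [← h1]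
  exact L.symm.measurePreserving.setLIntegral_comp_preimage_emb
    L.symm.toHomeomorph.measurableEmbedding F _

/-- **`RotationToAxis` holds** (item stmt-NavierStokesRegularity-26890 of route `AxisTwistDoor`): the
`e₃`-statement "no profile of the route's energy class with `⟪curl v, e₃⟫ ≥ 0` and linear `e₃`-ball growth is backward
singular at `(0,0)`" implies the same statement for every direction `e ≠ 0` — conjugate `(v, π, H)` by a determinant-one
linear isometry `L` with `L⁻¹e₃ = e/‖e‖`; every hypothesis of the class is rotation covariant, the sign and the ball
growth transform with the factor `‖e‖⁻¹`, and the origin stays backward singular. -/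
theorem rotationToAxis_proof :
    Summit.NavierStokesRegularity.NavierStokesRegularity.Theses.AxisTwistDoor.RotationToAxis := by
  intro hE3 e he C v π H hdecay hcont hmild hdiv hsw hwg hI hnn hK hsing
  obtain ⟨L, hL, hdet⟩ := exists_linearIsometryEquiv_det_one_symm_single_two he
  obtain ⟨hdecay', hcont', hmild', hdiv'⟩ := class_conj_linearIsometryEquiv L hdecay hcont hmild hdiv
  -- suitability (force `0` is transported to `0`)
  have hsw' := isSuitableWeakSolutionOn_conj hsw L
  have hf : (fun t x => L ((0 : ℝ → EuclideanSpace ℝ (Fin 3) → EuclideanSpace ℝ (Fin 3)) t (L.symm x))) = 0 := by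
    funext t x; simp
  rw [hf] at hsw'
  -- weak gradient, `𝐈`, backward singularity
  have hwg' := hasWeakSpatialGradientOn_conj hwg L
  have hI' : typeIBound (Iio (0 : ℝ) ×ˢ univ) (fun t x => L (v t (L.symm x))) (fun t x => π t (L.symm x))
      (fun t x => (L : EuclideanSpace ℝ (Fin 3) →L[ℝ] EuclideanSpace ℝ (Fin 3)).comp ((H t (L.symm x)).comp
        (L.symm : EuclideanSpace ℝ (Fin 3) →L[ℝ] EuclideanSpace ℝ (Fin 3)))) < ⊤ := by
    rwa [LIE.typeIBound_lowerHalf_conj]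
  have hsing' := LIE.isBackwardSingularPoint_zero_conj L hsing
  -- the pseudovector law with `det L = 1`: `⟪curl v'(s)(y), e₃⟫ = ‖e‖⁻¹ ⟪curl v(s)(L⁻¹ y), e⟫`
  have hkey : ∀ s y, ⟪curl (fun z => L (v s (L.symm z))) y, EuclideanSpace.single 2 1⟫_ℝ =
      ‖e‖⁻¹ * ⟪curl (v s) (L.symm y), e⟫_ℝ := by
    intro s y
    have h := inner_curl_conj_linearIsometryEquiv L (v s) y (L.symm (EuclideanSpace.single 2 1))
    rw [LinearIsometryEquiv.apply_symm_apply, hdet, one_mul, hL, inner_smul_right] at h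
    exact h
  have hnn' : ∀ s < 0, ∀ y, 0 ≤ ⟪curl ((fun t x => L (v t (L.symm x))) s) y,
      (EuclideanSpace.single (2 : Fin 3) (1 : ℝ))⟫_ℝ := by
    intro s hs y
    show 0 ≤ ⟪curl (fun z => L (v s (L.symm z))) y, EuclideanSpace.single 2 1⟫_ℝ
    rw [hkey]
    exact mul_nonneg (inv_nonneg.2 (norm_nonneg e)) (hnn s hs (L.symm y))
  -- ball growth with constant `K/‖e‖`
  have hK' : ∃ K' : ℝ, ∀ s < 0, ∀ (x : EuclideanSpace ℝ (Fin 3)) (R : ℝ), 0 < R →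
      ∫⁻ y in ball x R, ENNReal.ofReal ⟪curl ((fun t x => L (v t (L.symm x))) s) y,
        (EuclideanSpace.single (2 : Fin 3) (1 : ℝ))⟫_ℝ ≤ ENNReal.ofReal (K' * R) := by
    obtain ⟨K, hK⟩ := hK
    refine ⟨‖e‖⁻¹ * K, fun s hs x R hR => ?_⟩
    have h1 : (fun y => ENNReal.ofReal ⟪curl ((fun t x => L (v t (L.symm x))) s) y,
        (EuclideanSpace.single (2 : Fin 3) (1 : ℝ))⟫_ℝ) =
        fun y => ENNReal.ofReal ‖e‖⁻¹ * ENNReal.ofReal ⟪curl (v s) (L.symm y), e⟫_ℝ := by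
      funext y
      show ENNReal.ofReal ⟪curl (fun z => L (v s (L.symm z))) y, EuclideanSpace.single 2 1⟫_ℝ = _
      rw [hkey, ENNReal.ofReal_mul (inv_nonneg.2 (norm_nonneg e))]
    rw [h1, lintegral_const_mul' _ _ ENNReal.ofReal_ne_top,
      setLIntegral_ball_comp_symm L R x (fun z => ENNReal.ofReal ⟪curl (v s) z, e⟫_ℝ), mul_assoc,
      ENNReal.ofReal_mul (inv_nonneg.2 (norm_nonneg e))]
    exact mul_le_mul_right (hK s hs (L.symm x) R hR) _
  exact hE3 C (fun t x => L (v t (L.symm x))) (fun t x => π t (L.symm x))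
    (fun t x => (L : EuclideanSpace ℝ (Fin 3) →L[ℝ] EuclideanSpace ℝ (Fin 3)).comp ((H t (L.symm x)).comp
      (L.symm : EuclideanSpace ℝ (Fin 3) →L[ℝ] EuclideanSpace ℝ (Fin 3))))
    hdecay' hcont' hmild' hdiv' hsw' hwg' hI' hnn' hK' hsing'

end Summit.NavierStokesRegularity.NavierStokesRegularity.Theorems.AxisTwistDoorRotationToAxis

end
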